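import Mathlib
import Literature.Computability.Complexity.RangeAvoidance
import Literature.Computability.Complexity.SignDegreeXor
import HarnessLib.Audit
import Summits.PneNP.PneNP.Theorems.PstarPDT
import Summits.PneNP.PneNP.Theorems.PstarSALevel
import Summits.PneNP.PneNP.Theorems.PstarTyped
import Summits.PneNP.PneNP.Theorems.PstarResLinConjectures

/-!
# The gap lemma: the ROUND-24 crux behind `ExpanderPDTDepth` (depth adversary for parity decision trees)

FRONTIER range-avoidance ladder, rung F-N3, ROUND 24 (cell `pnp-ideate`, planner seat p3; restricted-model proof complexity —
nothing here bears on `P` versus `NP`).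

**The adversary.**  Against a parity decision tree for the falsified-output search problem of the fibre `I(z) = y`, an adversary
answers every query; after `t` answers the inputs consistent with the play form the solution set of a system `W` of `t` parity
constraints (`Finset (Finset (Fin n) × Bool)`, "`⊕_{v∈S} z_v = b`").  Call a set `J` of outputs `W`-FEASIBLE if some `z` satisfies
`W` and all outputs of `J` (`I.eval z j = y j`), and `W` `s`-FEASIBLE if every `J` with `|J| ≤ s` is.  If the final `W` is `1`-feasible
the leaf is wrong.  HALVING (free): if `W` is `r`-feasible then for every query `S` one of `W ∪ {S = 0}`, `W ∪ {S = 1}` is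
`⌊r/2⌋`-feasible (a `J₀` infeasible on one side and a `J₁` on the other make `J₀ ∪ J₁` infeasible in `W`).  RECOVERY (the crux): halving
alone dies in `log r` rounds; it is undone each round by

> **GAP LEMMA** `GapBound K r I y`: for every constraint system `W` and every MINIMAL `W`-infeasible `J` with `|J| ≤ r`:
> `|J| ≤ K · |W|`.

Indeed a `⌊r/2⌋`-feasible `W` with `K·|W| ≤ ⌊r/2⌋` is `r`-feasible (an infeasible `J`, `|J| ≤ r`, contains a minimal one, of size
`≤ K|W| ≤ ⌊r/2⌋`, which is feasible — contradiction), so the invariant "`W` is `r`-feasible" survives `⌊r/2⌋ / K` rounds: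
`GapAdversary` (T24.7, routine).  At `|W| = 0` the gap lemma says every `|J| ≤ r` is satisfiable for every target — the peeling
consequence of `(r, 3/2)`-boundary expansion (an output with two private positions is free: an XOR slot, or both AND slots).

**Why a gap lemma can only hold with bounded degrees, and why that is free.**  One constraint `a₀ = 0` linearises every output whose
AND pair contains `a₀`; with a second (dense) constraint on their XOR parts, the `deg(a₀)` outputs at `a₀` form a minimal infeasible set
with `|W| = 2`.  So `K ≥ deg/2`: the lemma is stated for instances of maximum variable degree `Δ` with `K = K(Δ)`
(`PstarGapLemma`), and the hard family is taken bounded-degree (`ExpandingTypedBoundedDegExist`, T24.9: the first-moment family of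
`PstarExpandingExist` after deleting the outputs at variables of degree `> Δ(C)` — a constant fraction `e^{-Ω(Δ)}` of them; boundary
expansion, purity and typing are inherited by sub-instances).  LINEARISATION IS LINEARLY BOUNDED (T24.8b): the outputs `j` whose AND
pair `{p_j, q_j}` supports a non-zero form of the span `U` of the constraint forms number at most `2Δ · dim U` (the weight-`≤ 2`
vectors of `U` span a graphic space on `≤ 2 dim U` coordinates).  KILLING FREE PRODUCTS COSTS RANK: a sum of `g` products on `2g`
distinct AND variables is constant on an affine subspace only if its codimension is `≥ g` (isotropic subspaces of a rank-`2g`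
alternating form) — the single-cycle case of the lemma (T24.8c).  The general case (overlapping cycles of the XOR graph, shared AND
variables, mixed constraints) is the research content of ROUND 24/25; a refutation of `PstarGapLemma` AS TYPED (some `Δ`, a sequence
of expanding typed pure instances of degree `≤ Δ` with minimal infeasible sets of size `≫ |W|`) would be equally informative — it
names the dense Prover strategy the Delayer must beat.

**Simple overlaps are necessary too (planner's self-refutation of the first typing, same day).**  Two outputs `j ≠ j'` with the SAME
AND pair `{p,q}` give the free width-4 XOR equation `f_j + f_{j'} = x_{u}+x_{v}+x_{u'}+x_{v'}`: `k` such couples on pairwise disjoint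
XOR edges form a pure typed instance of maximum degree `2` in which EVERY `J'` has `|bdry J'| ≥ 2|J'|` (so it is `(r,3/2)`-boundary
expanding for every `r`), and the single dense constraint `Σ_{all 2k outputs} (x_u + x_v) = 1 + Σ y` makes the `2k` outputs a minimal
infeasible set with `|W| = 1`: `PstarGapLemma` as first typed (without `SimpleOverlap`) is FALSE (refutation = prover item T24.8d,
`¬ PstarGapLemma`; the statement is kept below as the settled negative edge).  The live crux is `PstarGapLemmaSO`, which adds
`PstarSALevel.SimpleOverlap` (two outputs share at most one variable — excludes duplicated AND pairs and duplicated XOR edges; it is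
the overlap condition of the ROUND-21 headline supply `PstarSAHeadline.ExpandingTypedExist`).  Under `SimpleOverlap` + `MaxDegree Δ`
the cluster example `K_{Δ,Δ}` (AND pairs `P × Q`, `|P| = |Q| = Δ`, XOR edges disjoint; `W = {Σ_P a = 0, one dense XOR parity}`) shows
`K(Δ) ≥ Δ²/2`, and the rank route gives the matching upper bound in the one-dense-constraint case: `Q_J := Σ_{j∈J} a_{p_j}a_{q_j}`
constant on an affine subspace of codimension `t₀` forces `rank B_J ≤ 2t₀` (polarisation, T24.8c), while a simple graph of maximum
degree `Δ` has an induced matching of size `≥ |E|/(2Δ²)`, whence `rank_{𝔽₂} B_J ≥ |E|/Δ²` (T24.8c′) and `|J| ≤ 2Δ²·t₀`.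

**Declared here.** `Sat`, `Feasible`, `MinInfeasible`, `RFeasible`, `GapBound`, `MaxDegree` (definitions);
`PstarGapLemma` (first typing — REFUTABLE, kept as the negative edge), `PstarGapLemmaSO` (OPEN, the crux), `GapAdversary` (TARGET
T24.7, routine), `ExpandingTypedBoundedDegExist` / `ExpandingTypedBoundedDegSOExist` (TARGETS T24.9 / T24.9′, routine alteration); and
the proved assemblies `pstarPDTDepthLinear_of_gap` and `pstarPDTDepthLinear_of_gapSO : GapAdversary → PstarGapLemmaSO →
ExpandingTypedBoundedDegSOExist → PstarPDTDepthLinear` — the gap route reaches the ROUND-24 headline depth form by name.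
-/

set_option linter.dupNamespace false -- `Summit.PneNP.PneNP.…`: summit = sub-problem name (D-0017 single-conjunct layout)

open Finset Literature.Computability.Complexity
open Summit.PneNP.PneNP.Theorems.PstarPDT (PDT parity)
open Summit.PneNP.PneNP.Theorems.PstarTyped (Typed)
open Summit.PneNP.PneNP.Theorems.PstarSALevel (varSet BoundaryExpanding SimpleOverlap)
open Summit.PneNP.PneNP.Theorems.PstarResLinConjectures (PstarPDTDepthLinear)
open Summit.PneNP.PneNP.Theorems.PstarSA2Blind (exists_not_mem_range)

namespace Summit.PneNP.PneNP.Theorems.PstarGapLemma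

variable {k n m : ℕ}

/-- `z` satisfies the parity-constraint system `W` (each constraint `(S, b)` reads "`⊕_{v ∈ S} z_v = b`"). -/
def Sat (W : Finset (Finset (Fin n) × Bool)) (z : Fin n → Bool) : Prop :=
  ∀ e ∈ W, parity e.1 z = e.2

/-- The outputs of `J` are jointly satisfiable (`I.eval z j = y j`) by an assignment satisfying `W`. -/
def Feasible (I : LocalMap k n m) (y : Fin m → Bool) (W : Finset (Finset (Fin n) × Bool)) (J : Finset (Fin m)) : Prop :=
  ∃ z : Fin n → Bool, Sat W z ∧ ∀ j ∈ J, I.eval z j = y j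

/-- `J` is a MINIMAL `W`-infeasible set of outputs: infeasible, every one-smaller subset feasible. -/
def MinInfeasible (I : LocalMap k n m) (y : Fin m → Bool) (W : Finset (Finset (Fin n) × Bool)) (J : Finset (Fin m)) :
    Prop :=
  ¬ Feasible I y W J ∧ ∀ j ∈ J, Feasible I y W (J.erase j)

/-- `W` is `s`-feasible: every set of at most `s` outputs is `W`-feasible. -/
def RFeasible (I : LocalMap k n m) (y : Fin m → Bool) (s : ℕ) (W : Finset (Finset (Fin n) × Bool)) : Prop :=
  ∀ J : Finset (Fin m), J.card ≤ s → Feasible I y W J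

/-- **The gap bound with constant `K` in the range `r`**: every minimal `W`-infeasible set of at most `r` outputs has size at most
`K · |W|`. -/
def GapBound (K r : ℕ) (I : LocalMap k n m) (y : Fin m → Bool) : Prop :=
  ∀ (W : Finset (Finset (Fin n) × Bool)) (J : Finset (Fin m)), J.card ≤ r → MinInfeasible I y W J → J.card ≤ K * W.card

/-- Maximum variable degree at most `Δ`: every variable is read by at most `Δ` outputs. -/
def MaxDegree (Δ : ℕ) (I : LocalMap k n m) : Prop :=
  ∀ v : Fin n, (univ.filter fun j : Fin m => v ∈ varSet I j).card ≤ Δ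

/-- **The gap lemma, first typing (REFUTABLE — negative edge; see the module docstring and T24.8d).**  Without `SimpleOverlap`,
duplicated AND pairs give free width-4 XOR equations and one dense parity kills `2k` outputs: false for `Δ ≥ 2`.  Kept verbatim as the
record of what does NOT hold; the live statement is `PstarGapLemmaSO`.  FRONTIER. -/
@[conjecture] def PstarGapLemma : Prop :=
  ∀ Δ : ℕ, ∃ K : ℕ, 0 < K ∧ ∀ (n m r : ℕ) (I : LocalMap 4 n m), I.IsPure xorAndPred → Typed I → BoundaryExpanding r I →
    MaxDegree Δ I → ∀ y : Fin m → Bool, GapBound K r I y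

/-- **THE GAP LEMMA (OPEN; the ROUND-24 crux, repaired typing).**  For every degree bound `Δ` there is `K` such that on every pure
typed `(r, 3/2)`-boundary-expanding `P⋆` instance with simple overlaps and maximum degree `≤ Δ`, for every target and every
parity-constraint system `W`, every minimal `W`-infeasible set of at most `r` outputs has size `≤ K·|W|`.  With `GapAdversary` and
`ExpandingTypedBoundedDegSOExist` it gives `PstarPDTDepthLinear` (`pstarPDTDepthLinear_of_gapSO`).  Necessarily `K ≥ Δ²/2`
(`K_{Δ,Δ}` AND-cluster).  Known / provable cases: `|W| = 0` (peeling, T24.8a); `W` = affine constraints on AND variables plus ONE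
dense XOR parity, `J` XOR-acyclic: `|J| ≤ 2Δ²·|W|` by the rank route (T24.8c polarisation + T24.8c′ induced matching); forcing chains
(each constraint pins `O(1)` products, ratio `O(Δ)`).  Why it might fail: several dense XOR parities closing different sub-families
`T₁,…,T_s ⊆ J` give a quadratic system `{Q_T(a) = c_T : T ∈ ⟨Tᵢ⟩}` on the AND variables whose unsatisfiable cores might grow like
`s·|W_A|` rather than `s + |W_A|` — the bias identity `Σ_{T≠0} ±2^{-rank_A(Q_T)/2} = 1` bounds each involved form's rank but not yet
their number.  FRONTIER. -/
@[conjecture] def PstarGapLemmaSO : Prop :=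
  ∀ Δ : ℕ, ∃ K : ℕ, 0 < K ∧ ∀ (n m r : ℕ) (I : LocalMap 4 n m), I.IsPure xorAndPred → Typed I → BoundaryExpanding r I →
    SimpleOverlap I → MaxDegree Δ I → ∀ y : Fin m → Bool, GapBound K r I y

/-- **The adversary from the gap bound (TARGET T24.7, routine).**  If `GapBound K r I y` holds then every parity decision tree solving
the falsified-output search problem of the fibre `y` has depth `> (⌊r/2⌋ - K)/K`: invariant "`W` is `r`-feasible", halving to
`⌊r/2⌋`, recovery by the gap bound while `K·|W| ≤ ⌊r/2⌋`; a `1`-feasible final system refutes the leaf.  Any locality `k`. -/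
@[conjecture] def GapAdversary : Prop :=
  ∀ (k n m K r : ℕ) (I : LocalMap k n m) (y : Fin m → Bool), GapBound K r I y →
    ∀ T : PDT n m, T.Solves I y → r ≤ 2 * K * T.depth + 1

/-- **Bounded-degree expanding typed supply (TARGET T24.9, routine alteration).**  At every linear stretch there are pure typed
`(n/c, 3/2)`-boundary-expanding `P⋆` instances with `n < m`, `m ≥ C·n` and maximum variable degree `≤ Δ = Δ(C)`: delete from the
first-moment family of `PstarExpandingExist.expandingTypedExist'` (run at stretch `2C`, say) every output at a variable of degree
`> Δ`; expansion, purity and typing pass to sub-instances. -/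
@[conjecture] def ExpandingTypedBoundedDegExist : Prop :=
  ∀ C : ℕ, ∃ c Δ : ℕ, 0 < c ∧ ∀ N : ℕ, ∃ n, N ≤ n ∧ ∃ m, n < m ∧ C * n ≤ m ∧
    ∃ I : LocalMap 4 n m, I.IsPure xorAndPred ∧ Typed I ∧ BoundaryExpanding (n / c) I ∧ MaxDegree Δ I

/-- **Bounded-degree expanding typed supply with simple overlaps (TARGET T24.9′, routine alteration)** = the ROUND-21 headline
supply `PstarSAHeadline.ExpandingTypedExist` (simple overlaps, ratio-`7/4` alteration) with the extra conjunct `MaxDegree Δ(C)`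
(delete the outputs at variables of degree `> Δ`; a binomial tail makes them an `e^{-Ω(Δ)}` fraction). -/
@[conjecture] def ExpandingTypedBoundedDegSOExist : Prop :=
  ∀ C : ℕ, ∃ c Δ : ℕ, 0 < c ∧ ∀ N : ℕ, ∃ n, N ≤ n ∧ ∃ m, n < m ∧ C * n ≤ m ∧
    ∃ I : LocalMap 4 n m, I.IsPure xorAndPred ∧ Typed I ∧ BoundaryExpanding (n / c) I ∧ SimpleOverlap I ∧ MaxDegree Δ I

/-- Forgetting the overlap condition. -/
theorem expandingTypedBoundedDegExist_of_SO (h : ExpandingTypedBoundedDegSOExist) : ExpandingTypedBoundedDegExist := by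
  intro C
  obtain ⟨c, Δ, hc, hS⟩ := h C
  refine ⟨c, Δ, hc, fun N => ?_⟩
  obtain ⟨n, hNn, m, hnm, hCm, I, hP, hT, hB, -, hD⟩ := hS N
  exact ⟨n, hNn, m, hnm, hCm, I, hP, hT, hB, hD⟩

/-- **The gap route reaches the headline**: adversary + gap lemma + bounded-degree supply ⇒ `PstarPDTDepthLinear`. -/
theorem pstarPDTDepthLinear_of_gap (hA : GapAdversary) (hG : PstarGapLemma) (hE : ExpandingTypedBoundedDegExist) :
    PstarPDTDepthLinear := by
  intro C
  obtain ⟨c₁, Δ, hc₁, hS⟩ := hE C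
  obtain ⟨K, hK, hGap⟩ := hG Δ
  refine ⟨2 * c₁ * (K + 1), by positivity, fun N => ?_⟩
  obtain ⟨n, hNn, m, hnm, hCm, I, hP, hT, hB, hD⟩ := hS N
  refine ⟨n, hNn, m, hCm, I, hP, exists_not_mem_range I hnm, fun y hy T hTs => ?_⟩
  have h1 : n / c₁ ≤ 2 * K * T.depth + 1 := hA 4 n m K (n / c₁) I y (hGap n m (n / c₁) I hP hT hB hD y) T hTs
  have h2 : n < (n / c₁ + 1) * c₁ := by
    have e1 := Nat.div_add_mod n c₁
    have e2 := Nat.mod_lt n hc₁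
    nlinarith [e1, e2]
  have h3 : (n / c₁ + 1) * c₁ ≤ (2 * K * T.depth + 2) * c₁ := Nat.mul_le_mul_right _ (by omega)
  have h4 : (2 * K * T.depth + 2) * c₁ ≤ 2 * c₁ * (K + 1) * (T.depth + 1) := by
    have e : 2 * c₁ * (K + 1) * (T.depth + 1) = (2 * K * T.depth + 2) * c₁ + 2 * c₁ * (K * 1 + T.depth) := by ring
    omega
  omega

/-- **The repaired gap route reaches the headline**: adversary + gap lemma (simple overlaps, bounded degree) + supply ⇒
`PstarPDTDepthLinear`. -/
theorem pstarPDTDepthLinear_of_gapSO (hA : GapAdversary) (hG : PstarGapLemmaSO) (hE : ExpandingTypedBoundedDegSOExist) :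
    PstarPDTDepthLinear := by
  intro C
  obtain ⟨c₁, Δ, hc₁, hS⟩ := hE C
  obtain ⟨K, hK, hGap⟩ := hG Δ
  refine ⟨2 * c₁ * (K + 1), by positivity, fun N => ?_⟩
  obtain ⟨n, hNn, m, hnm, hCm, I, hP, hT, hB, hO, hD⟩ := hS N
  refine ⟨n, hNn, m, hCm, I, hP, exists_not_mem_range I hnm, fun y hy T hTs => ?_⟩
  have h1 : n / c₁ ≤ 2 * K * T.depth + 1 := hA 4 n m K (n / c₁) I y (hGap n m (n / c₁) I hP hT hB hO hD y) T hTs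
  have h2 : n < (n / c₁ + 1) * c₁ := by
    have e1 := Nat.div_add_mod n c₁
    have e2 := Nat.mod_lt n hc₁
    nlinarith [e1, e2]
  have h3 : (n / c₁ + 1) * c₁ ≤ (2 * K * T.depth + 2) * c₁ := Nat.mul_le_mul_right _ (by omega)
  have h4 : (2 * K * T.depth + 2) * c₁ ≤ 2 * c₁ * (K + 1) * (T.depth + 1) := by
    have e : 2 * c₁ * (K + 1) * (T.depth + 1) = (2 * K * T.depth + 2) * c₁ + 2 * c₁ * (K * 1 + T.depth) := by ring
    omega
  omega

/-! ### Sanity: the definitions unfold as intended -/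

/-- The empty system is satisfied by every assignment. -/
theorem sat_empty (z : Fin n → Bool) : Sat (∅ : Finset (Finset (Fin n) × Bool)) z := by
  simp [Sat]

/-- A gap bound forbids non-empty minimal infeasible sets of size `≤ r` under the empty system. -/
theorem card_eq_zero_of_gapBound {K r : ℕ} {I : LocalMap k n m} {y : Fin m → Bool} (h : GapBound K r I y)
    {J : Finset (Fin m)} (hJ : J.card ≤ r) (hmin : MinInfeasible I y ∅ J) : J = ∅ := by
  have := h ∅ J hJ hmin
  simpa using this

end Summit.PneNP.PneNP.Theorems.PstarGapLemma
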